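import Literature.NumberTheory.GelbartRogawski1991.UnitaryDualPairGramDiagonalCM
import Literature.NumberTheory.Weil1964.ArchUnitaryWeilHalf
import Literature.NumberTheory.Automorphic.ConjugateSelfDualCharacters
import HarnessLib

/-!
# The negative sign count of `V ⊗ ⟨a⟩` at a real place, and the central weight of a weight-one type on a hermitian LINE

Topic `NumberTheory/Weil1964`; namespace `Literature.NumberTheory.Weil1964`.  KERNEL ONLY: proved theorems (two `private` counting
helpers tagged [folklore]), no definitions, no records, no named facts, no `sorry`.

For a CM field `L` (maximal real subfield `L⁺`), conjugation-fixed non-zero `dV : Fin N → L` (the diagonal Gram datum of a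
hermitian space `V`) and a hermitian LINE `W = ⟨a⟩`, `dW = ![a]` (`dW : Fin 1 → L`), the canonical sign vector of
`𝕎 = Res_{L/L⁺}(V ⊗ W)` at a real place `v` of `L⁺` ([KonnoKonno2007, §3.1]; the tree's `signVec (cmPlaceOver L) (cmGramEntry …)
(imagUnit L) v`, entries `σ_v(dVᵢ · a) / im σ_{w(v)}(δ_L)`) has

* **`card_negIdx_signVec_line`**: `q_v(𝕎) = #{i | σ_v(dVᵢ) < 0}` negative entries if `0 < σ_v(a) · im σ_{w(v)}(δ_L)` and
  `N − #{i | σ_v(dVᵢ) < 0}` otherwise (`w(v) = cmPlaceOver L v`, `σ_v(x) = re (w(v).embedding x)` on `L⁺`);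
* **`central_line_weightOneType`**: for the weight-one ∞-type `τ = weightOneType Φ` of a CM type `Φ` ([Liu2021, Remark 4.2]:
  `τ_w = −1` iff `w.embedding ∈ Φ`), the integer `N (τ_{w(v)} + 1)/2 − q_v(𝕎)` — the exponent by which the archimedean centre
  of `U(V)` acts on the Fock vacuum of `𝕎_v` through a splitting of unitary archimedean type `(τ, 0)` ([KonnoKonno2007, Lemma 5.2]:
  `p e_P + q e_Q`, `(e_P, e_Q) = ((τ+1)/2, (τ−1)/2)`) — equals `τ_{w(v)} · q` if the two memberships
  `w(v).embedding ∈ Φ` and `0 < σ_v(a) · im (w(v).embedding δ_L)` (i.e. `w(v).embedding ∈ Φ^δ(a) := {φ | 0 < im φ(δ_L a)}`) AGREE,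
  and `τ_{w(v)} · (N − q)` if they disagree, `q = #{i | σ_v(dVᵢ) < 0}`;
* the two cases a CM hermitian space of signature `(N,0)`, `(N−1,1)` presents: **`central_line_weightOneType_of_pos`** (`q = 0`:
  the weight is `0` on agreement, `N τ` on disagreement; `…_eq_zero_iff`: for `N ≠ 0` it vanishes IFF the memberships agree) and
  **`central_line_weightOneType_of_one_neg`** (`q = 1`: the weight is `τ = ∓1` on agreement, `(N−1) τ` on disagreement;
  `natAbs_…_eq_one_iff`: for `N ≠ 2` it is `±1` IFF the memberships agree);
* **`central_line_weightOneType_table`**: signature `(N−1,1)` at `v₁`, `(N,0)` elsewhere, `Φ` agreeing with `Φ^δ(a)` at every place ⟹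
  the weight is `𝟙_{v₁} · τ_{w(v₁)}`;
* **`central_line_weightOneType_table_of_deltaPos`**: the same for `Φ` CUT OUT by `δ_L a` (`φ ∈ Φ ↔ 0 < im φ(δ_L a)`, Liu's `Φ^δ(a)`),
  with NO agreement hypothesis (`im_embedding_imagUnit_mul_pos_iff`: membership of `w(v).embedding` IS the sign condition; `weightOneType_of_deltaPos`);
* primed forms `central_line_weightOneType'`, `central_line_weightOneType_table'`, `…_table_of_deltaPos'` with the TOTAL size `n` (`Fin n ≃ Fin N × Fin 1`, `n = N`:
  `eq_of_line_equiv`) in front — the literal shape `n (τ_w + 1)/2 − q_{v(w)}` of a central type defined over `Fin n`.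

Consequence (bookkeeping for the consumer, nothing of it is used here): on a CM hermitian space positive definite off one place `v₁` and
of signature `(N−1,1)` at `v₁`, `N ≥ 3`, the weight table of `weightOneType Φ` on the line `⟨a⟩` takes values in `{0}` off `w(v₁)` and
in `{±1}` at `w(v₁)` iff `Φ = Φ^δ(a)`, and then it is `𝟙_{w(v₁)} · weightOneType Φ^δ(a)`: `−𝟙_{w(v₁)}` iff `w(v₁).embedding ∈ Φ^δ(a)` —
keyed on the place's DISTINGUISHED embedding `w(v₁).embedding = (InfinitePlace.mk ι₁).embedding ∈ {ι₁, ῑ₁}`, not on `ι₁`.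
References: K. Konno, T. Konno, Kyushu J. Math. 61 (2007), §3.1, Lemma 5.2 [KonnoKonno2007]; Y. Liu, Camb. J. Math. 9 (2021), §4.1
Remark 4.2, App. D Lem. D.2 [Liu2021]; S. Gelbart, J. Rogawski, Invent. Math. 105 (1991), §3.1 p. 454 [GelbartRogawski1991].
-/

set_option autoImplicit false

noncomputable section

open scoped Classical
open NumberField NumberField.InfinitePlace
open Literature.NumberTheory.GelbartRogawski1991.UnitaryDualPair (cmGramEntry imagUnit)
open Literature.NumberTheory.Automorphic.IdeleClassGroup (weightOneType)
open Literature.AlgebraicGeometry.Motives (CMType)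

namespace Literature.NumberTheory.Weil1964

section LineSignCount

variable (L : Type) [Field L] [NumberField L] [IsCMField L] {N n : ℕ} (e : Fin N × Fin 1 ≃ Fin n)
  (dV : Fin N → L) (hdV : ∀ i, IsCMField.complexConj L (dV i) = dV i)
  (dW : Fin 1 → L) (hdW : ∀ i, IsCMField.complexConj L (dW i) = dW i)

/-- the distinguished embedding of `w(v) = cmPlaceOver L v` lies over `v`. [cite: GelbartRogawski1991, §3.1 p. 454] -/
theorem comap_mk_embedding_cmPlaceOver (v : {v : InfinitePlace ↥(maximalRealSubfield L) // v.IsReal}) :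
    (InfinitePlace.mk (cmPlaceOver L v).1.embedding).comap (algebraMap (↥(maximalRealSubfield L)) L) = v.1 := by
  rw [mk_embedding]; exact cmPlaceOver_comap L v

variable {N' : ℕ} in
/-- `σ_v(dᵢ) = re (w(v).embedding dᵢ)` for conjugation-fixed `dᵢ`. [cite: GelbartRogawski1991, §3.1 p. 454] -/
theorem embedding_of_isReal_cmRealVec_eq_re (v : {v : InfinitePlace ↥(maximalRealSubfield L) // v.IsReal})
    (d : Fin N' → L) (hd : ∀ i, IsCMField.complexConj L (d i) = d i) (i : Fin N') :
    embedding_of_isReal v.2 (cmRealVec L d hd i) = ((cmPlaceOver L v).1.embedding (d i)).re := by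
  have h := congrArg Complex.re
    (embedding_of_isReal_cmRealVec L v (cmPlaceOver L v).1.embedding (comap_mk_embedding_cmPlaceOver L v) d hd i)
  rwa [Complex.ofReal_re] at h

variable {N' : ℕ} in
/-- `re τ(dᵢ) = re (w(v).embedding dᵢ)` for ANY complex embedding `τ` over `v` (both are `σ_v(dᵢ)`; in particular the real parts
through `ι₁` and through `(InfinitePlace.mk ι₁).embedding ∈ {ι₁, ῑ₁}` agree). [cite: GelbartRogawski1991, §3.1 p. 454] -/
theorem re_embedding_eq_re_embedding_cmPlaceOver (v : {v : InfinitePlace ↥(maximalRealSubfield L) // v.IsReal})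
    (τ : L →+* ℂ) (hτ : (InfinitePlace.mk τ).comap (algebraMap (↥(maximalRealSubfield L)) L) = v.1)
    (d : Fin N' → L) (hd : ∀ i, IsCMField.complexConj L (d i) = d i) (i : Fin N') :
    (τ (d i)).re = ((cmPlaceOver L v).1.embedding (d i)).re := by
  have h := congrArg Complex.re (embedding_of_isReal_cmRealVec L v τ hτ d hd i)
  rw [Complex.ofReal_re] at h
  rw [← h, embedding_of_isReal_cmRealVec_eq_re]

variable {N' : ℕ} in
/-- `re (w(v).embedding dᵢ) ≠ 0` for `dᵢ ≠ 0` conjugation-fixed. [cite: GelbartRogawski1991, §3.1 p. 454] -/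
theorem re_embedding_cmPlaceOver_ne_zero (v : {v : InfinitePlace ↥(maximalRealSubfield L) // v.IsReal})
    (d : Fin N' → L) (hd : ∀ i, IsCMField.complexConj L (d i) = d i) {i : Fin N'} (hd0 : d i ≠ 0) :
    ((cmPlaceOver L v).1.embedding (d i)).re ≠ 0 := by
  rw [← embedding_of_isReal_cmRealVec_eq_re L v d hd i]
  exact (map_ne_zero _).2 fun h => hd0 (congrArg Subtype.val h)

variable {N' : ℕ} in
/-- `im (w(v).embedding dᵢ) = 0` for conjugation-fixed `dᵢ` (`w(v).embedding dᵢ = σ_v(dᵢ)` is real). [cite: GelbartRogawski1991, §3.1 p. 454] -/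
theorem im_embedding_cmPlaceOver_eq_zero (v : {v : InfinitePlace ↥(maximalRealSubfield L) // v.IsReal})
    (d : Fin N' → L) (hd : ∀ i, IsCMField.complexConj L (d i) = d i) (i : Fin N') :
    ((cmPlaceOver L v).1.embedding (d i)).im = 0 := by
  have h := congrArg Complex.im
    (embedding_of_isReal_cmRealVec L v (cmPlaceOver L v).1.embedding (comap_mk_embedding_cmPlaceOver L v) d hd i)
  rw [Complex.ofReal_im] at h
  exact h.symm

/-- **membership of `w(v).embedding` in the δ-positive type `Φ^δ(a) = {φ | 0 < im φ(δ_L · a)}`** ([Liu2021, Def. 4.12]'s CM type of the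
line `⟨a⟩`) is the sign condition `0 < σ_v(a) · im (w(v).embedding δ_L)` of the sign vector. [cite: Liu2021, Definition 4.12] -/
theorem im_embedding_imagUnit_mul_pos_iff (hdW : ∀ i, IsCMField.complexConj L (dW i) = dW i)
    (v : {v : InfinitePlace ↥(maximalRealSubfield L) // v.IsReal}) :
    0 < ((cmPlaceOver L v).1.embedding (imagUnit L * dW 0)).im ↔
      0 < ((cmPlaceOver L v).1.embedding (dW 0)).re * ((cmPlaceOver L v).1.embedding (imagUnit L)).im := by
  rw [map_mul, Complex.mul_im, im_embedding_cmPlaceOver_eq_zero L v dW hdW 0, mul_zero, zero_add, mul_comm]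

/-- **the sign vector of `V ⊗ ⟨a⟩` at `v`, entrywise**: `x_v(k) = σ_v(dV (e⁻¹ k)₁) · (σ_v(a) / im σ_{w(v)}(δ_L))`.
[cite: KonnoKonno2007, §3.1] -/
theorem signVec_cmGramEntry_line_apply (v : {v : InfinitePlace ↥(maximalRealSubfield L) // v.IsReal}) (k : Fin n) :
    signVec (cmPlaceOver L) (cmGramEntry L e dV hdV dW hdW) (imagUnit L) v k =
      ((cmPlaceOver L v).1.embedding (dV (e.symm k).1)).re *
        (((cmPlaceOver L v).1.embedding (dW 0)).re / ((cmPlaceOver L v).1.embedding (imagUnit L)).im) := by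
  have h2 : (e.symm k).2 = 0 := Fin.eq_zero _
  show embedding_of_isReal v.2 (cmRealVec L dV hdV (e.symm k).1 * cmRealVec L dW hdW (e.symm k).2) /
      ((cmPlaceOver L v).1.embedding (imagUnit L)).im = _
  rw [map_mul, h2, embedding_of_isReal_cmRealVec_eq_re, embedding_of_isReal_cmRealVec_eq_re, mul_div_assoc]

/-- counting the non-positive entries of `i ↦ yᵢ · s` for non-zero `yᵢ`: `#{yᵢ < 0}` if `0 < s`, `N − #{yᵢ < 0}` if `s < 0`. [folklore] -/
private theorem card_not_pos_mul_eq (y : Fin N → ℝ) (hy : ∀ i, y i ≠ 0) {s : ℝ} (hs : s ≠ 0) :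
    Fintype.card {i : Fin N // ¬0 < y i * s} =
      if 0 < s then Fintype.card {i : Fin N // y i < 0} else N - Fintype.card {i : Fin N // y i < 0} := by
  rcases lt_or_gt_of_ne hs with hs | hs
  · rw [if_neg (not_lt.2 hs.le)]
    have hN : Fintype.card {i : Fin N // 0 < y i} + Fintype.card {i : Fin N // y i < 0} = N := by
      rw [Fintype.card_subtype, Fintype.card_subtype, ← Finset.card_union_of_disjoint
        (Finset.disjoint_filter.2 fun i _ h h' => lt_asymm h h')]
      conv_rhs => rw [← Fintype.card_fin N, ← Finset.card_univ]
      congr 1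
      ext i
      simp only [Finset.mem_union, Finset.mem_filter, Finset.mem_univ, true_and, iff_true]
      exact (lt_or_gt_of_ne (hy i)).symm
    have hc : Fintype.card {i : Fin N // ¬0 < y i * s} = Fintype.card {i : Fin N // 0 < y i} := by
      refine Fintype.card_congr (Equiv.subtypeEquivRight fun i => ?_)
      rw [not_lt, mul_nonpos_iff]
      constructor
      · rintro (⟨h0, -⟩ | ⟨-, h⟩)
        · exact lt_of_le_of_ne h0 (hy i).symm
        · exact absurd h (not_le.2 hs)
      · exact fun h => Or.inl ⟨h.le, hs.le⟩
    omega
  · rw [if_pos hs]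
    refine Fintype.card_congr (Equiv.subtypeEquivRight fun i => ?_)
    rw [not_lt, mul_nonpos_iff]
    constructor
    · rintro (⟨-, h⟩ | ⟨h0, -⟩)
      · exact absurd h (not_le.2 hs)
      · exact lt_of_le_of_ne h0 (hy i)
    · exact fun h => Or.inr ⟨h.le, hs.le⟩

/-- **the negative sign count of `V ⊗ ⟨a⟩` at a real place** `v`: `q_v(𝕎) = #{i | σ_v(dVᵢ) < 0}` if `0 < σ_v(a) · im σ_{w(v)}(δ_L)`,
else `N − #{i | σ_v(dVᵢ) < 0}`. [cite: KonnoKonno2007, §3.1] -/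
theorem card_negIdx_signVec_line (hdV0 : ∀ i, dV i ≠ 0) (hdW0 : dW 0 ≠ 0)
    (v : {v : InfinitePlace ↥(maximalRealSubfield L) // v.IsReal}) :
    Fintype.card (NegIdx (signVec (cmPlaceOver L) (cmGramEntry L e dV hdV dW hdW) (imagUnit L) v)) =
      if 0 < ((cmPlaceOver L v).1.embedding (dW 0)).re * ((cmPlaceOver L v).1.embedding (imagUnit L)).im then
        Fintype.card {i : Fin N // ((cmPlaceOver L v).1.embedding (dV i)).re < 0}
      else N - Fintype.card {i : Fin N // ((cmPlaceOver L v).1.embedding (dV i)).re < 0} := by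
  have hs : ((cmPlaceOver L v).1.embedding (dW 0)).re / ((cmPlaceOver L v).1.embedding (imagUnit L)).im ≠ 0 :=
    div_ne_zero (re_embedding_cmPlaceOver_ne_zero L v dW hdW hdW0) (im_embedding_cmPlaceOver_imagUnit_ne_zero L v)
  have hE : Fintype.card (NegIdx (signVec (cmPlaceOver L) (cmGramEntry L e dV hdV dW hdW) (imagUnit L) v)) =
      Fintype.card {i : Fin N // ¬0 < ((cmPlaceOver L v).1.embedding (dV i)).re *
        (((cmPlaceOver L v).1.embedding (dW 0)).re / ((cmPlaceOver L v).1.embedding (imagUnit L)).im)} := by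
    refine Fintype.card_congr ((Equiv.subtypeEquiv (e.symm.trans (Equiv.prodUnique (Fin N) (Fin 1)))) fun k => ?_)
    rw [signVec_cmGramEntry_line_apply]
    rfl
  rw [hE, card_not_pos_mul_eq (fun i => ((cmPlaceOver L v).1.embedding (dV i)).re)
    (fun i => re_embedding_cmPlaceOver_ne_zero L v dV hdV (hdV0 i)) hs]
  simp only [div_pos_iff, mul_pos_iff]

/-- `#{i | σ_v(dVᵢ) < 0} ≤ N`. [folklore] -/
private theorem card_re_neg_le (v : {v : InfinitePlace ↥(maximalRealSubfield L) // v.IsReal}) :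
    Fintype.card {i : Fin N // ((cmPlaceOver L v).1.embedding (dV i)).re < 0} ≤ N :=
  (Fintype.card_subtype_le _).trans (Fintype.card_fin N).le

/-- **the central weight of a weight-one type on a line**: with `τ = weightOneType Φ`, `w = w(v)`, `q = #{i | σ_v(dVᵢ) < 0}`,
`N (τ_w + 1)/2 − q_v(𝕎) = τ_w · q` if the memberships `w.embedding ∈ Φ` and `0 < σ_v(a) · im (w.embedding δ_L)` agree, and
`= τ_w · (N − q)` if they disagree. [cite: KonnoKonno2007, Lemma 5.2 p. 73] [cite: Liu2021, Remark 4.2] -/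
theorem central_line_weightOneType (hdV0 : ∀ i, dV i ≠ 0) (hdW0 : dW 0 ≠ 0) (Φ : CMType L)
    (v : {v : InfinitePlace ↥(maximalRealSubfield L) // v.IsReal}) :
    (N : ℤ) * ((weightOneType L Φ (cmPlaceOver L v).1 + 1) / 2) -
        (Fintype.card (NegIdx (signVec (cmPlaceOver L) (cmGramEntry L e dV hdV dW hdW) (imagUnit L) v)) : ℤ) =
      weightOneType L Φ (cmPlaceOver L v).1 *
        if ((cmPlaceOver L v).1.embedding ∈ Φ.1 ↔
            0 < ((cmPlaceOver L v).1.embedding (dW 0)).re * ((cmPlaceOver L v).1.embedding (imagUnit L)).im) then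
          (Fintype.card {i : Fin N // ((cmPlaceOver L v).1.embedding (dV i)).re < 0} : ℤ)
        else (N : ℤ) - Fintype.card {i : Fin N // ((cmPlaceOver L v).1.embedding (dV i)).re < 0} := by
  rw [card_negIdx_signVec_line L e dV hdV dW hdW hdV0 hdW0 v]
  have hq := card_re_neg_le L dV v
  unfold weightOneType
  by_cases hm : (cmPlaceOver L v).1.embedding ∈ Φ.1 <;>
    by_cases hs : 0 < ((cmPlaceOver L v).1.embedding (dW 0)).re * ((cmPlaceOver L v).1.embedding (imagUnit L)).im <;>
    simp only [hm, hs, if_true, if_false, iff_true, iff_false, not_true_eq_false, Nat.cast_sub hq] <;>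
    omega

/-- **at a `V`-DEFINITE place** (`0 < σ_v(dVᵢ)` for all `i`): the central weight is `0` if the memberships agree and `N τ_w` if not.
[cite: KonnoKonno2007, Lemma 5.2 p. 73] [cite: Liu2021, App. D Lem. D.2 (1)] -/
theorem central_line_weightOneType_of_pos (hdW0 : dW 0 ≠ 0) (Φ : CMType L)
    (v : {v : InfinitePlace ↥(maximalRealSubfield L) // v.IsReal}) (hpos : ∀ i, 0 < ((cmPlaceOver L v).1.embedding (dV i)).re) :
    (N : ℤ) * ((weightOneType L Φ (cmPlaceOver L v).1 + 1) / 2) -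
        (Fintype.card (NegIdx (signVec (cmPlaceOver L) (cmGramEntry L e dV hdV dW hdW) (imagUnit L) v)) : ℤ) =
      if ((cmPlaceOver L v).1.embedding ∈ Φ.1 ↔
          0 < ((cmPlaceOver L v).1.embedding (dW 0)).re * ((cmPlaceOver L v).1.embedding (imagUnit L)).im) then 0
      else (N : ℤ) * weightOneType L Φ (cmPlaceOver L v).1 := by
  have hq : Fintype.card {i : Fin N // ((cmPlaceOver L v).1.embedding (dV i)).re < 0} = 0 :=
    Fintype.card_eq_zero_iff.2 ⟨fun i => lt_asymm i.2 (hpos i.1)⟩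
  rw [central_line_weightOneType L e dV hdV dW hdW (fun i h => (hpos i).ne' (by rw [h, map_zero, Complex.zero_re])) hdW0 Φ v, hq]
  split_ifs <;> push_cast <;> ring

/-- at a `V`-definite place, `N ≠ 0`: **the central weight vanishes IFF `w(v).embedding ∈ Φ ↔ w(v).embedding ∈ Φ^δ(a)`**.
[cite: KonnoKonno2007, Lemma 5.2 p. 73] [cite: Liu2021, App. D Lem. D.2 (1)] -/
theorem central_line_weightOneType_eq_zero_iff [NeZero N] (hdW0 : dW 0 ≠ 0) (Φ : CMType L)
    (v : {v : InfinitePlace ↥(maximalRealSubfield L) // v.IsReal}) (hpos : ∀ i, 0 < ((cmPlaceOver L v).1.embedding (dV i)).re) :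
    (N : ℤ) * ((weightOneType L Φ (cmPlaceOver L v).1 + 1) / 2) -
        (Fintype.card (NegIdx (signVec (cmPlaceOver L) (cmGramEntry L e dV hdV dW hdW) (imagUnit L) v)) : ℤ) = 0 ↔
      ((cmPlaceOver L v).1.embedding ∈ Φ.1 ↔
        0 < ((cmPlaceOver L v).1.embedding (dW 0)).re * ((cmPlaceOver L v).1.embedding (imagUnit L)).im) := by
  rw [central_line_weightOneType_of_pos L e dV hdV dW hdW hdW0 Φ v hpos]
  refine ⟨fun h => ?_, fun h => if_pos h⟩
  by_contra hne
  rw [if_neg hne] at h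
  exact mul_ne_zero (Int.natCast_ne_zero.2 (NeZero.ne N))
    (Literature.NumberTheory.Automorphic.IdeleClassGroup.weightOneType_ne_zero Φ _) h

/-- **at the place of signature `(N−1,1)`** (exactly one `σ_v(dV i₀) < 0`): the central weight is `τ_w = ∓1` if the memberships agree
and `(N−1) τ_w` if not. [cite: KonnoKonno2007, Lemma 5.2 p. 73] [cite: Liu2021, App. D Lem. D.2 (2)] -/
theorem central_line_weightOneType_of_one_neg (hdW0 : dW 0 ≠ 0) (Φ : CMType L)
    (v : {v : InfinitePlace ↥(maximalRealSubfield L) // v.IsReal}) (i₀ : Fin N)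
    (hneg : ((cmPlaceOver L v).1.embedding (dV i₀)).re < 0) (hpos : ∀ i, i ≠ i₀ → 0 < ((cmPlaceOver L v).1.embedding (dV i)).re) :
    (N : ℤ) * ((weightOneType L Φ (cmPlaceOver L v).1 + 1) / 2) -
        (Fintype.card (NegIdx (signVec (cmPlaceOver L) (cmGramEntry L e dV hdV dW hdW) (imagUnit L) v)) : ℤ) =
      if ((cmPlaceOver L v).1.embedding ∈ Φ.1 ↔
          0 < ((cmPlaceOver L v).1.embedding (dW 0)).re * ((cmPlaceOver L v).1.embedding (imagUnit L)).im) then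
        weightOneType L Φ (cmPlaceOver L v).1
      else ((N : ℤ) - 1) * weightOneType L Φ (cmPlaceOver L v).1 := by
  have hdV0 : ∀ i, dV i ≠ 0 := by
    intro i h
    by_cases hi : i = i₀
    · subst hi; rw [h, map_zero, Complex.zero_re] at hneg; exact lt_irrefl _ hneg
    · exact (hpos i hi).ne' (by rw [h, map_zero, Complex.zero_re])
  have hq : Fintype.card {i : Fin N // ((cmPlaceOver L v).1.embedding (dV i)).re < 0} = 1 := by
    rw [Fintype.card_eq_one_iff]
    refine ⟨⟨i₀, hneg⟩, fun i => Subtype.ext ?_⟩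
    by_contra hi
    exact lt_asymm i.2 (hpos i.1 hi)
  rw [central_line_weightOneType L e dV hdV dW hdW hdV0 hdW0 Φ v, hq]
  split_ifs <;> push_cast <;> ring

omit [NumberField L] [IsCMField L] in
/-- `|weightOneType Φ w| = 1`. [cite: Liu2021, Remark 4.2] -/
theorem natAbs_weightOneType (Φ : CMType L) (w : InfinitePlace L) : (weightOneType L Φ w).natAbs = 1 := by
  unfold weightOneType
  split_ifs <;> rfl

/-- at the place of signature `(N−1,1)`, `N ≠ 2`: **the central weight is `±1` IFF `w(v).embedding ∈ Φ ↔ w(v).embedding ∈ Φ^δ(a)`**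
(on disagreement it is `±(N−1)`). [cite: KonnoKonno2007, Lemma 5.2 p. 73] [cite: Liu2021, App. D Lem. D.2 (2)] -/
theorem natAbs_central_line_weightOneType_eq_one_iff (hN : N ≠ 2) (hdW0 : dW 0 ≠ 0) (Φ : CMType L)
    (v : {v : InfinitePlace ↥(maximalRealSubfield L) // v.IsReal}) (i₀ : Fin N)
    (hneg : ((cmPlaceOver L v).1.embedding (dV i₀)).re < 0) (hpos : ∀ i, i ≠ i₀ → 0 < ((cmPlaceOver L v).1.embedding (dV i)).re) :
    ((N : ℤ) * ((weightOneType L Φ (cmPlaceOver L v).1 + 1) / 2) -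
        (Fintype.card (NegIdx (signVec (cmPlaceOver L) (cmGramEntry L e dV hdV dW hdW) (imagUnit L) v)) : ℤ)).natAbs = 1 ↔
      ((cmPlaceOver L v).1.embedding ∈ Φ.1 ↔
        0 < ((cmPlaceOver L v).1.embedding (dW 0)).re * ((cmPlaceOver L v).1.embedding (imagUnit L)).im) := by
  rw [central_line_weightOneType_of_one_neg L e dV hdV dW hdW hdW0 Φ v i₀ hneg hpos]
  have h1 := natAbs_weightOneType L Φ (cmPlaceOver L v).1
  have hN0 : N ≠ 0 := fun h => by subst h; exact Fin.elim0 i₀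
  refine ⟨fun h => ?_, fun h => by rwa [if_pos h]⟩
  by_contra hne
  rw [if_neg hne, Int.natAbs_mul, h1, mul_one] at h
  omega

/-- **THE WEIGHT TABLE OF A WEIGHT-ONE TYPE ON A LINE** over a hermitian space of signature `(N−1,1)` at `v₁` and `(N,0)` elsewhere, for a
CM type `Φ` that AGREES with `Φ^δ(a)` at every place (`w(v).embedding ∈ Φ ↔ 0 < σ_v(a) · im (w(v).embedding δ_L)`; automatic for
`Φ = Φ^δ(a)`): `N (τ_{w(v)} + 1)/2 − q_v(𝕎) = 𝟙_{v₁}(v) · τ_{w(v₁)}` — `0` off `v₁`, `weightOneType Φ w(v₁) = ∓1` at `v₁` as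
`w(v₁).embedding ∈ Φ` or not. [cite: KonnoKonno2007, Lemma 5.2 p. 73] [cite: Liu2021, App. D Lem. D.2] -/
theorem central_line_weightOneType_table (hdW0 : dW 0 ≠ 0) (Φ : CMType L)
    (v₁ : {v : InfinitePlace ↥(maximalRealSubfield L) // v.IsReal}) (i₀ : Fin N)
    (hneg : ((cmPlaceOver L v₁).1.embedding (dV i₀)).re < 0)
    (hpos₁ : ∀ i, i ≠ i₀ → 0 < ((cmPlaceOver L v₁).1.embedding (dV i)).re)
    (hpos : ∀ v, v ≠ v₁ → ∀ i, 0 < ((cmPlaceOver L v).1.embedding (dV i)).re)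
    (hagree : ∀ v : {v : InfinitePlace ↥(maximalRealSubfield L) // v.IsReal}, ((cmPlaceOver L v).1.embedding ∈ Φ.1 ↔
      0 < ((cmPlaceOver L v).1.embedding (dW 0)).re * ((cmPlaceOver L v).1.embedding (imagUnit L)).im))
    (v : {v : InfinitePlace ↥(maximalRealSubfield L) // v.IsReal}) :
    (N : ℤ) * ((weightOneType L Φ (cmPlaceOver L v).1 + 1) / 2) -
        (Fintype.card (NegIdx (signVec (cmPlaceOver L) (cmGramEntry L e dV hdV dW hdW) (imagUnit L) v)) : ℤ) =
      if v = v₁ then weightOneType L Φ (cmPlaceOver L v₁).1 else 0 := by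
  by_cases hv : v = v₁
  · subst hv
    rw [if_pos rfl, central_line_weightOneType_of_one_neg L e dV hdV dW hdW hdW0 Φ v i₀ hneg hpos₁, if_pos (hagree v)]
  · rw [if_neg hv, central_line_weightOneType_of_pos L e dV hdV dW hdW hdW0 Φ v (hpos v hv), if_pos (hagree v)]

/-- **THE WEIGHT TABLE OF `weightOneType Φ^δ(a)` ON THE LINE `⟨a⟩`** — `Φ` the CM type CUT OUT by `δ_L a` (`φ ∈ Φ ↔ 0 < im φ(δ_L a)`):
signature `(N−1,1)` at `v₁`, `(N,0)` elsewhere ⟹ `N (τ_{w(v)} + 1)/2 − q_v(𝕎) = 𝟙_{v₁}(v) · τ_{w(v₁)}`, with NO agreement ∕ orientation hypothesis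
(the `im (w(v).embedding δ_L)` of the sign vector cancels against the `w(v).embedding ∈ Φ` of the type, place by place).
[cite: KonnoKonno2007, Lemma 5.2 p. 73] [cite: Liu2021, Definition 4.12, App. D Lem. D.2] -/
theorem central_line_weightOneType_table_of_deltaPos (hdW0 : dW 0 ≠ 0) (Φ : CMType L)
    (hΦ : ∀ φ : L →+* ℂ, φ ∈ Φ.1 ↔ 0 < (φ (imagUnit L * dW 0)).im)
    (v₁ : {v : InfinitePlace ↥(maximalRealSubfield L) // v.IsReal}) (i₀ : Fin N)
    (hneg : ((cmPlaceOver L v₁).1.embedding (dV i₀)).re < 0)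
    (hpos₁ : ∀ i, i ≠ i₀ → 0 < ((cmPlaceOver L v₁).1.embedding (dV i)).re)
    (hpos : ∀ v, v ≠ v₁ → ∀ i, 0 < ((cmPlaceOver L v).1.embedding (dV i)).re)
    (v : {v : InfinitePlace ↥(maximalRealSubfield L) // v.IsReal}) :
    (N : ℤ) * ((weightOneType L Φ (cmPlaceOver L v).1 + 1) / 2) -
        (Fintype.card (NegIdx (signVec (cmPlaceOver L) (cmGramEntry L e dV hdV dW hdW) (imagUnit L) v)) : ℤ) =
      if v = v₁ then weightOneType L Φ (cmPlaceOver L v₁).1 else 0 :=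
  central_line_weightOneType_table L e dV hdV dW hdW hdW0 Φ v₁ i₀ hneg hpos₁ hpos
    (fun v => (hΦ _).trans (im_embedding_imagUnit_mul_pos_iff L dW hdW v)) v

/-- the value at `v₁` in the same situation: `weightOneType Φ^δ(a) (w(v₁)) = −1` if `0 < σ_{v₁}(a) · im (w(v₁).embedding δ_L)`, else `+1`.
[cite: Liu2021, Remark 4.2, Definition 4.12] -/
theorem weightOneType_of_deltaPos (hdW : ∀ i, IsCMField.complexConj L (dW i) = dW i) (Φ : CMType L)
    (hΦ : ∀ φ : L →+* ℂ, φ ∈ Φ.1 ↔ 0 < (φ (imagUnit L * dW 0)).im)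
    (v : {v : InfinitePlace ↥(maximalRealSubfield L) // v.IsReal}) :
    weightOneType L Φ (cmPlaceOver L v).1 =
      if 0 < ((cmPlaceOver L v).1.embedding (dW 0)).re * ((cmPlaceOver L v).1.embedding (imagUnit L)).im then -1 else 1 := by
  have key := (hΦ (cmPlaceOver L v).1.embedding).trans (im_embedding_imagUnit_mul_pos_iff L dW hdW v)
  unfold weightOneType
  by_cases h : 0 < ((cmPlaceOver L v).1.embedding (dW 0)).re * ((cmPlaceOver L v).1.embedding (imagUnit L)).im
  · rw [if_pos h, if_pos (key.2 h)]
  · rw [if_neg h, if_neg fun hm => h (key.1 hm)]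

/-- on a line the total index size is the rank of `V`: `n = N` for `e : Fin N × Fin 1 ≃ Fin n`. [cite: KonnoKonno2007, §3.1] -/
theorem eq_of_line_equiv (e : Fin N × Fin 1 ≃ Fin n) : n = N := by
  simpa [Fintype.card_prod, Fintype.card_fin] using Fintype.card_congr e.symm

/-- `central_line_weightOneType` with the TOTAL size `n` (`= N`) in front, the shape of a central type
`m_w = n (τ_w + 1)/2 − q_{v(w)}` defined over `Fin n ≃ Fin N × Fin 1`. [cite: KonnoKonno2007, Lemma 5.2 p. 73] [cite: Liu2021, Remark 4.2] -/
theorem central_line_weightOneType' (hdV0 : ∀ i, dV i ≠ 0) (hdW0 : dW 0 ≠ 0) (Φ : CMType L)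
    (v : {v : InfinitePlace ↥(maximalRealSubfield L) // v.IsReal}) :
    (n : ℤ) * ((weightOneType L Φ (cmPlaceOver L v).1 + 1) / 2) -
        (Fintype.card (NegIdx (signVec (cmPlaceOver L) (cmGramEntry L e dV hdV dW hdW) (imagUnit L) v)) : ℤ) =
      weightOneType L Φ (cmPlaceOver L v).1 *
        if ((cmPlaceOver L v).1.embedding ∈ Φ.1 ↔
            0 < ((cmPlaceOver L v).1.embedding (dW 0)).re * ((cmPlaceOver L v).1.embedding (imagUnit L)).im) then
          (Fintype.card {i : Fin N // ((cmPlaceOver L v).1.embedding (dV i)).re < 0} : ℤ)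
        else (n : ℤ) - Fintype.card {i : Fin N // ((cmPlaceOver L v).1.embedding (dV i)).re < 0} := by
  obtain rfl : n = N := eq_of_line_equiv e
  exact central_line_weightOneType L e dV hdV dW hdW hdV0 hdW0 Φ v

/-- `central_line_weightOneType_table` with the total size `n` in front. [cite: KonnoKonno2007, Lemma 5.2 p. 73] [cite: Liu2021, App. D Lem. D.2] -/
theorem central_line_weightOneType_table' (hdW0 : dW 0 ≠ 0) (Φ : CMType L)
    (v₁ : {v : InfinitePlace ↥(maximalRealSubfield L) // v.IsReal}) (i₀ : Fin N)
    (hneg : ((cmPlaceOver L v₁).1.embedding (dV i₀)).re < 0)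
    (hpos₁ : ∀ i, i ≠ i₀ → 0 < ((cmPlaceOver L v₁).1.embedding (dV i)).re)
    (hpos : ∀ v, v ≠ v₁ → ∀ i, 0 < ((cmPlaceOver L v).1.embedding (dV i)).re)
    (hagree : ∀ v : {v : InfinitePlace ↥(maximalRealSubfield L) // v.IsReal}, ((cmPlaceOver L v).1.embedding ∈ Φ.1 ↔
      0 < ((cmPlaceOver L v).1.embedding (dW 0)).re * ((cmPlaceOver L v).1.embedding (imagUnit L)).im))
    (v : {v : InfinitePlace ↥(maximalRealSubfield L) // v.IsReal}) :
    (n : ℤ) * ((weightOneType L Φ (cmPlaceOver L v).1 + 1) / 2) -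
        (Fintype.card (NegIdx (signVec (cmPlaceOver L) (cmGramEntry L e dV hdV dW hdW) (imagUnit L) v)) : ℤ) =
      if v = v₁ then weightOneType L Φ (cmPlaceOver L v₁).1 else 0 := by
  obtain rfl : n = N := eq_of_line_equiv e
  exact central_line_weightOneType_table L e dV hdV dW hdW hdW0 Φ v₁ i₀ hneg hpos₁ hpos hagree v

/-- `central_line_weightOneType_table_of_deltaPos` with the total size `n` in front. [cite: KonnoKonno2007, Lemma 5.2 p. 73]
[cite: Liu2021, Definition 4.12, App. D Lem. D.2] -/
theorem central_line_weightOneType_table_of_deltaPos' (hdW0 : dW 0 ≠ 0) (Φ : CMType L)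
    (hΦ : ∀ φ : L →+* ℂ, φ ∈ Φ.1 ↔ 0 < (φ (imagUnit L * dW 0)).im)
    (v₁ : {v : InfinitePlace ↥(maximalRealSubfield L) // v.IsReal}) (i₀ : Fin N)
    (hneg : ((cmPlaceOver L v₁).1.embedding (dV i₀)).re < 0)
    (hpos₁ : ∀ i, i ≠ i₀ → 0 < ((cmPlaceOver L v₁).1.embedding (dV i)).re)
    (hpos : ∀ v, v ≠ v₁ → ∀ i, 0 < ((cmPlaceOver L v).1.embedding (dV i)).re)
    (v : {v : InfinitePlace ↥(maximalRealSubfield L) // v.IsReal}) :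
    (n : ℤ) * ((weightOneType L Φ (cmPlaceOver L v).1 + 1) / 2) -
        (Fintype.card (NegIdx (signVec (cmPlaceOver L) (cmGramEntry L e dV hdV dW hdW) (imagUnit L) v)) : ℤ) =
      if v = v₁ then weightOneType L Φ (cmPlaceOver L v₁).1 else 0 := by
  obtain rfl : n = N := eq_of_line_equiv e
  exact central_line_weightOneType_table_of_deltaPos L e dV hdV dW hdW hdW0 Φ hΦ v₁ i₀ hneg hpos₁ hpos v

end LineSignCount

end Literature.NumberTheory.Weil1964

end
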